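import Literature.NumberTheory.LFunctions.Zhang2022.RepairRplus

/-!
# Zhang (2022), programme F-S3 §E (cell landau-siegel, barrier extension, seat p3): the TWO-BLOCK CRITERION —
# «bulk ⊕ (band | wall | jump) block with a coupling» is non-negative on every design iff the block is `≥ 0`
# and the coupling is Cauchy–Schwarz-subordinate; the wall world of B-multi's class M3 as an instance

Y. Zhang, *Discrete mean estimates and the Landau–Siegel zero*, arXiv:2211.02515v1 [Zhang2022LandauSiegel] —
an unrefereed manuscript under adjudication. **WHAT THIS IS NOT: not a claim about Theorems 1–2 of
arXiv:2211.02515, about Landau–Siegel zeros, about a repaired `Margin232`, or about Parity; nothing here asserts any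
claim of the manuscript. The programme SEARCHES and TYPES; no claim until a kernel theorem says so.** Companion of
`RepairRplus` (p455670: `Repair.DesignFamily`, `Repair.Rplus`, `Repair.rplus_extend`) and of the seat's
`KnifeEdgeRoughOverhang` (rough two-piece class; its `KnifeEdge.nullOn_iff` is the instance «bulk = in-class piece,
block = net overhang block, coupling = cross residual» of the criterion below).

**The shape every non-smooth design of the cell reduces to** (OBJECTIVE §1.3 (O1), B-multi PLAN v1.1 §1/§6/§9, rows
E-005 «E*-band», E-006 «E*-cross», E-028 «E-multi-jump», E-034 «E-multi-band», E-035 «E-cross-neg»): the would-be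
main constant of a design `s·u ⊕ w` — a BULK profile `u` scaled by `s ∈ ℂ` and a second datum `w` (an overhang
piece, a wall value with a band profile, a jump list, …) — is a two-block pencil
`q(s) = a(u)·|s|² + 2Re(s·c(u,w)) + r(w)` (`twoBlockPencil`) with `a(u) ≥ 0` the bulk block (for `u ∈ H¹[0,1]`, any
wall value `u(1⁻)`: `a(u) = 𝔅(u) = mainTermForm u u′ ≥ 0`, `mainTermForm_nonneg_of_isH1` — a THEOREM), `r(w)` the
second block (band variance / jump term — its sign `+` is the lever (B1) of the cell's LEVERS §0.6, NOT a theorem: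
DISPLAYED as the slot `BandNonneg`) and `c(u,w)` the coupling (bulk × band cross term — slot `CrossSubordinate`).

**The criterion (`twoBlockPencil_nonneg_iff`, `TwoBlockWorld.null_iff`).** For `a ≥ 0`:
`(∀ s, q(s) ≥ 0) ↔ (r ≥ 0 ∧ ‖c‖² ≤ a·r)` — Sylvester's criterion for the Hermitian `2×2` matrix `[[a, c̄],[c, r]]`
[Horn–Johnson, *Matrix Analysis* (2nd ed.), Thm 7.2.5(a) with Obs 7.1.5, `n = 2`]; an iff with `≤`, so the degenerate
bulk modes `a(u) = 0` are covered (there the coupling must VANISH). Consequences for a WORLD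
(`TwoBlockWorld P Q` = the three functionals `bulk`, `cross`, `band` on design data types `P`, `Q`):
`null_iff` (no design closes ⟺ `BandNonneg ∧ CrossSubordinate`, given `BulkNonneg` and one bulk datum),
`not_closes`, `closes_needs_cross` (a closing design exhibits `a(u)·r(w) < ‖c(u,w)‖²`: a coupling of E*-strength —
row E-035, «beyond its own Cauchy–Schwarz maximum»), and the algebraic certificate `twoBlockPencil_ge_of_subordinate`
(`q(s) ≥ a|s|² − 2√(a r)|s| + r = (√a|s| − √r)²` under subordination — B-multi PLAN §1 M3 «OBJ ≥ (√𝔅 − √V)²»).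

**The wall world (`wallWorld`, family `familyWall`).** B-multi's class-of-record object for its live sub-class M3
(PLAN v1.1 §9.7 «object of record = the design TRUNCATED AT THE WALL with wall data recorded»): bulk data = ANY `H¹`
profile `u` on `[0,1]` (wall value `u(1⁻)` free — no `u(1) = 0`), bulk block `𝔅(u)`; second data = an arbitrary type
`Q` (the typers' wall/band/jump records, e.g. `WallData`, to be plugged in when typed); a world = the two functionals
`cross`, `band` the `X`-world induces on them. `familyWall Q : Repair.DesignFamily` has class «`u ∈ H¹[0,1]`» (NO
analytic hypothesis) and verdict «in every world whose band blocks are `≥ 0` and whose couplings are subordinate,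
`¬ (q < 0)`»; `familyWall_decided`, `rplus_wall_decided : ClassDecided (Rplus ++ [familyWall Q])`. Slot-conditional:
nothing is «killed» unconditionally; the lever is located (`familyWall_closes_needs_cross`).

Deliberately NOT here: any instantiation of `Q`, `cross`, `band` (rows E-005/E-006/E-028/E-034 are the typers'); three
or more coupled blocks (pairwise subordination does NOT imply joint positivity for `≥ 3` blocks — the honest slot there
is positivity of the whole completed Gram matrix); numeric certificates (none: structural). Axioms standard.
References: Zhang, arXiv:2211.02515v1, §7 Prop 7.1, (7.2) p.44 [cite: Zhang2022LandauSiegel, §7 Prop 7.1 (7.2)];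
Horn–Johnson, *Matrix Analysis*, 2nd ed., Thm 7.2.5 p.538 [cite: HornJohnson2013, Thm 7.2.5]; cell charter
LS-PROGRAMME v1.1 §2 row E; barrier/ASSIGNMENTS.md rows S-E-p3-1, S-E-p3-2; B-multi/PLAN.md v1.1 §6, §9.6–9.7.
-/

noncomputable section

open Complex Real ComplexConjugate Set
open _root_.MeasureTheory

namespace Literature.NumberTheory.LFunctions.Zhang2022

namespace KnifeEdge

open Repair

/-! ### Part 1 — the two-block pencil and Sylvester's criterion for `n = 2` -/

/-- The completed two-block pencil `q(s) = a|s|² + 2Re(s·c) + r` of a design `s·u ⊕ w`: bulk block `a`, coupling `c`,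
second block `r`. [cite: Zhang2022LandauSiegel, Prop 7.1 p.44, (7.2)] -/
def twoBlockPencil (a : ℝ) (c : ℂ) (r : ℝ) (s : ℂ) : ℝ := a * ‖s‖ ^ 2 + 2 * (s * c).re + r

variable {a r : ℝ} {c : ℂ}

/-- `q(0) = r`. [cite: Zhang2022LandauSiegel, Prop 7.1 p.44, (7.2)] -/
theorem twoBlockPencil_zero (a : ℝ) (c : ℂ) (r : ℝ) : twoBlockPencil a c r 0 = r := by
  simp [twoBlockPencil]

/-- Along the ray `s = t·conj c` (`t` real) the pencil is the real quadratic `a‖c‖²t² + 2‖c‖²t + r`.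
[cite: HornJohnson2013, Thm 7.2.5] -/
theorem twoBlockPencil_ray (a : ℝ) (c : ℂ) (r t : ℝ) :
    twoBlockPencil a c r ((t : ℂ) * conj c) = a * ‖c‖ ^ 2 * t ^ 2 + 2 * ‖c‖ ^ 2 * t + r := by
  unfold twoBlockPencil
  have hn : ‖(t : ℂ) * conj c‖ ^ 2 = ‖c‖ ^ 2 * t ^ 2 := by
    rw [norm_mul, Complex.norm_conj, Complex.norm_real, Real.norm_eq_abs, mul_pow, sq_abs]; ring
  have hre : ((t : ℂ) * conj c * c).re = ‖c‖ ^ 2 * t := by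
    rw [mul_assoc, Complex.conj_mul' c, ← Complex.ofReal_pow, ← Complex.ofReal_mul, Complex.ofReal_re]
    ring
  rw [hn, hre]
  ring

/-- **Sylvester's criterion, `n = 2`.** For `a ≥ 0`: the pencil `a|s|² + 2Re(s·c) + r` is `≥ 0` for every complex `s`
iff `r ≥ 0` and `‖c‖² ≤ a·r` — i.e. the Hermitian matrix `[[a, c̄], [c, r]]` is positive semidefinite iff its
principal minors are `≥ 0`. An iff with `≤`: for `a = 0` it forces `c = 0`. [cite: HornJohnson2013, Thm 7.2.5] -/
theorem twoBlockPencil_nonneg_iff (ha : 0 ≤ a) :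
    (∀ s : ℂ, 0 ≤ twoBlockPencil a c r s) ↔ (0 ≤ r ∧ ‖c‖ ^ 2 ≤ a * r) := by
  have e2 : ‖c‖ ^ 2 = c.re ^ 2 + c.im ^ 2 := by rw [Complex.sq_norm, Complex.normSq_apply]; ring
  constructor
  · intro h
    have hr : 0 ≤ r := by simpa [twoBlockPencil_zero] using h 0
    refine ⟨hr, ?_⟩
    have key : ∀ t : ℝ, 0 ≤ a * ‖c‖ ^ 2 * t ^ 2 + 2 * ‖c‖ ^ 2 * t + r := fun t => by
      rw [← twoBlockPencil_ray]; exact h _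
    rcases eq_or_ne c 0 with hc0 | hc0
    · rw [hc0, norm_zero]; simpa using mul_nonneg ha hr
    · have hcn : 0 < ‖c‖ := norm_pos_iff.2 hc0
      rcases eq_or_lt_of_le ha with ha0 | hapos
      · exfalso
        have h1 := key (-(r + 1) / (2 * ‖c‖ ^ 2))
        rw [← ha0] at h1
        have hcn' : ‖c‖ ≠ 0 := hcn.ne'
        have e : 2 * ‖c‖ ^ 2 * (-(r + 1) / (2 * ‖c‖ ^ 2)) = -(r + 1) := by field_simp
        rw [zero_mul, zero_mul, zero_add, e] at h1
        linarith
      · have h1 := key (-1 / a)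
        have hne : a ≠ 0 := hapos.ne'
        have e : a * ‖c‖ ^ 2 * (-1 / a) ^ 2 + 2 * ‖c‖ ^ 2 * (-1 / a) + r = r - ‖c‖ ^ 2 / a := by
          field_simp
          ring
        rw [e, sub_nonneg, div_le_iff₀ hapos] at h1
        linarith
  · rintro ⟨hr, hcs⟩ s
    unfold twoBlockPencil
    have e1 : ‖s‖ ^ 2 = s.re ^ 2 + s.im ^ 2 := by rw [Complex.sq_norm, Complex.normSq_apply]; ring
    have e3 : (s * c).re = s.re * c.re - s.im * c.im := Complex.mul_re _ _
    rw [e1, e3]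
    rw [e2] at hcs
    rcases eq_or_lt_of_le ha with ha0 | hapos
    · rw [← ha0] at hcs ⊢
      have hc1 : c.re = 0 := by nlinarith [sq_nonneg c.re, sq_nonneg c.im]
      have hc2 : c.im = 0 := by nlinarith [sq_nonneg c.re, sq_nonneg c.im]
      rw [hc1, hc2]; linarith
    · have key : 0 ≤ a * (a * (s.re ^ 2 + s.im ^ 2) + 2 * (s.re * c.re - s.im * c.im) + r) := by
        nlinarith [sq_nonneg (a * s.re + c.re), sq_nonneg (a * s.im - c.im)]
      exact (mul_nonneg_iff_of_pos_left hapos).1 key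

/-- **The lever direction, explicit.** If `a ≥ 0`, `r ≥ 0` but the coupling beats the geometric mean
(`a·r < ‖c‖²`), the pencil IS negative somewhere. [cite: HornJohnson2013, Thm 7.2.5] -/
theorem twoBlockPencil_neg_of_cross (ha : 0 ≤ a) (hlt : a * r < ‖c‖ ^ 2) : ∃ s : ℂ, twoBlockPencil a c r s < 0 := by
  by_contra hcon
  push Not at hcon
  have := ((twoBlockPencil_nonneg_iff ha).1 hcon).2
  linarith

/-- **The algebraic certificate** (B-multi PLAN §1 M3, «OBJ ≥ (√𝔅 − √V)²»): under subordination
`‖c‖² ≤ a·r` (`a, r ≥ 0`), `q(s) ≥ a|s|² − 2√(a r)|s| + r = (√a·|s| − √r)²`. [cite: HornJohnson2013, Thm 7.2.5] -/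
theorem twoBlockPencil_ge_of_subordinate (ha : 0 ≤ a) (hr : 0 ≤ r) (hcs : ‖c‖ ^ 2 ≤ a * r) (s : ℂ) :
    (Real.sqrt a * ‖s‖ - Real.sqrt r) ^ 2 ≤ twoBlockPencil a c r s := by
  unfold twoBlockPencil
  have h1 : |(s * c).re| ≤ ‖s‖ * ‖c‖ := by
    calc |(s * c).re| ≤ ‖s * c‖ := Complex.abs_re_le_norm _
      _ = ‖s‖ * ‖c‖ := norm_mul _ _
  have h2 : ‖c‖ ≤ Real.sqrt a * Real.sqrt r := by
    rw [← Real.sqrt_mul ha, ← Real.sqrt_sq (norm_nonneg c)]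
    exact Real.sqrt_le_sqrt hcs
  have hsa : Real.sqrt a ^ 2 = a := Real.sq_sqrt ha
  have hsr : Real.sqrt r ^ 2 = r := Real.sq_sqrt hr
  have hs0 : 0 ≤ ‖s‖ := norm_nonneg _
  have h3 : -(‖s‖ * (Real.sqrt a * Real.sqrt r)) ≤ (s * c).re := by
    have := neg_abs_le (s * c).re
    nlinarith
  nlinarith [Real.sqrt_nonneg a, Real.sqrt_nonneg r]

/-! ### Part 2 — worlds: the three functionals on design data, the null, the slots, the criterion -/

/-- **A two-block world** on bulk data `P` and second data `Q`: the bulk block `bulk : P → ℝ` (e.g. `𝔅(u)`), the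
coupling `cross : P → Q → ℂ` (the bulk × band / bulk × overhang cross term of the `X`-world) and the second block
`band : Q → ℝ` (band variance / net overhang block / jump term). Pure data; which world is the (A)-world is the
cell's registry question (E-005/E-006/E-028/E-034), not asserted. [cite: Zhang2022LandauSiegel, Prop 7.1 p.44, (7.2)] -/
structure TwoBlockWorld (P Q : Type) : Type where
  /-- the bulk block `a(u)` -/
  bulk : P → ℝ
  /-- the coupling `c(u,w)` -/
  cross : P → Q → ℂ
  /-- the second block `r(w)` -/
  band : Q → ℝ

namespace TwoBlockWorld

variable {P Q : Type}

/-- the world's pencil on the design `s·p ⊕ q`. [cite: Zhang2022LandauSiegel, Prop 7.1 p.44, (7.2)] -/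
def pencil (W : TwoBlockWorld P Q) (p : P) (q : Q) (s : ℂ) : ℝ :=
  twoBlockPencil (W.bulk p) (W.cross p q) (W.band q) s

/-- NULL of a world `W` (a predicate on worlds): no design has a negative constant. Candidate shape, NOT asserted
for any particular world. [cite: Zhang2022LandauSiegel, Prop 7.1 p.44, (7.2)] -/
def Null (W : TwoBlockWorld P Q) : Prop := ∀ (p : P) (q : Q) (s : ℂ), 0 ≤ W.pencil p q s

/-- CLOSES (a predicate on worlds): some design has a negative constant. Candidate shape, NOT asserted.
[cite: Zhang2022LandauSiegel, Prop 7.1 p.44, (7.2)] -/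
def Closes (W : TwoBlockWorld P Q) : Prop := ∃ (p : P) (q : Q) (s : ℂ), W.pencil p q s < 0

/-- bulk blocks `≥ 0` (a predicate on worlds; a THEOREM for `𝔅` on `H¹`, `wallWorld_bulkNonneg`; a slot when jump
terms are folded into the bulk). [cite: Zhang2022LandauSiegel, Prop 7.1 p.44, (7.2)] -/
def BulkNonneg (W : TwoBlockWorld P Q) : Prop := ∀ p : P, 0 ≤ W.bulk p

/-- **Slot (rows E-005 / E-034 / E-028), a predicate on worlds, DISPLAYED, NOT asserted:** second blocks `≥ 0` —
the sign the positivity lever (B1) assigns to a correctly derived band / jump term.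
[cite: Zhang2022LandauSiegel, Prop 7.1 p.44, (7.2)] -/
def BandNonneg (W : TwoBlockWorld P Q) : Prop := ∀ q : Q, 0 ≤ W.band q

/-- **Slot (row E-006), a predicate on worlds, DISPLAYED, NOT asserted:** couplings Cauchy–Schwarz-subordinate,
`‖c(u,w)‖² ≤ a(u)·r(w)` (its failure at some design = row E-035, the lever).
[cite: Zhang2022LandauSiegel, Prop 7.1 p.44, (7.2)] -/
def CrossSubordinate (W : TwoBlockWorld P Q) : Prop := ∀ (p : P) (q : Q), ‖W.cross p q‖ ^ 2 ≤ W.bulk p * W.band q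

variable {W : TwoBlockWorld P Q}

/-- closing is the failure of the null. [cite: Zhang2022LandauSiegel, Prop 7.1 p.44, (7.2)] -/
theorem closes_iff_not_null : W.Closes ↔ ¬ W.Null := by
  unfold Closes Null
  push Not
  exact Iff.rfl

/-- **THE CRITERION for a world** (bulk blocks `≥ 0`, at least one bulk datum): no design closes iff the second
blocks are `≥ 0` and the couplings are subordinate. [cite: HornJohnson2013, Thm 7.2.5] -/
theorem null_iff (hP : Nonempty P) (hB : W.BulkNonneg) : W.Null ↔ W.BandNonneg ∧ W.CrossSubordinate := by
  constructor
  · intro h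
    have crit : ∀ p q, 0 ≤ W.band q ∧ ‖W.cross p q‖ ^ 2 ≤ W.bulk p * W.band q := fun p q =>
      (twoBlockPencil_nonneg_iff (hB p)).1 fun s => h p q s
    obtain ⟨p₀⟩ := hP
    exact ⟨fun q => (crit p₀ q).1, fun p q => (crit p q).2⟩
  · rintro ⟨hb, hc⟩ p q s
    exact (twoBlockPencil_nonneg_iff (hB p)).2 ⟨hb q, hc p q⟩ s

/-- **NO CLOSING** in a world with bulk blocks `≥ 0`, second blocks `≥ 0`, subordinate couplings.
[cite: HornJohnson2013, Thm 7.2.5] -/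
theorem not_closes (hB : W.BulkNonneg) (hb : W.BandNonneg) (hc : W.CrossSubordinate) : ¬ W.Closes := by
  rintro ⟨p, q, s, hlt⟩
  exact not_lt.2 ((twoBlockPencil_nonneg_iff (hB p)).2 ⟨hb q, hc p q⟩ s) hlt

/-- **THE LEVER, LOCATED**: a closing design in a world with bulk and second blocks `≥ 0` exhibits a coupling beyond
the geometric mean, `a(u)·r(w) < ‖c(u,w)‖²`. [cite: HornJohnson2013, Thm 7.2.5] -/
theorem closes_needs_cross (hB : W.BulkNonneg) (hb : W.BandNonneg) (h : W.Closes) :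
    ∃ (p : P) (q : Q), W.bulk p * W.band q < ‖W.cross p q‖ ^ 2 := by
  by_contra hcon
  push Not at hcon
  exact not_closes hB hb (fun p q => hcon p q) h

/-- … and conversely such a design does close. [cite: HornJohnson2013, Thm 7.2.5] -/
theorem closes_of_cross (hB : W.BulkNonneg) {p : P} {q : Q} (hlt : W.bulk p * W.band q < ‖W.cross p q‖ ^ 2) :
    W.Closes := by
  obtain ⟨s, hs⟩ := twoBlockPencil_neg_of_cross (hB p) hlt
  exact ⟨p, q, s, hs⟩

/-- On a degenerate bulk mode (`a(u) = 0`) subordination forces the coupling to VANISH.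
[cite: HornJohnson2013, Thm 7.2.5] -/
theorem cross_eq_zero_of_bulk_zero (hc : W.CrossSubordinate) {p : P} (q : Q) (h0 : W.bulk p = 0) :
    W.cross p q = 0 := by
  have h := hc p q
  rw [h0, zero_mul] at h
  exact norm_eq_zero.1 (pow_eq_zero_iff two_ne_zero |>.1 (le_antisymm h (sq_nonneg _)))

/-- the algebraic certificate in a world: under the slots, `q(s) ≥ (√a(u)·|s| − √r(w))²`.
[cite: HornJohnson2013, Thm 7.2.5] -/
theorem pencil_ge_sq (hB : W.BulkNonneg) (hb : W.BandNonneg) (hc : W.CrossSubordinate) (p : P) (q : Q) (s : ℂ) :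
    (Real.sqrt (W.bulk p) * ‖s‖ - Real.sqrt (W.band q)) ^ 2 ≤ W.pencil p q s :=
  twoBlockPencil_ge_of_subordinate (hB p) (hb q) (hc p q) s

end TwoBlockWorld

/-! ### Part 3 — the wall world of B-multi's sub-class M3: bulk = any `H¹` profile on `[0,1]`, wall value free -/

/-- Bulk data of the wall world: an `H¹` profile on `[0,1]` with its marked derivative — ANY wall value `u(1⁻)`
(sharp cut-off at `n = P` allowed: the object of record is the design truncated at the wall).
[cite: Zhang2022LandauSiegel, Prop 7.1 p.44, (7.2)] -/
abbrev H1Bulk : Type := {p : (ℝ → ℂ) × (ℝ → ℂ) // IsH1OnUnitInterval p.1 p.2}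

/-- the zero profile is a bulk datum. [cite: Zhang2022LandauSiegel, Prop 7.1 p.44, (7.2)] -/
def H1Bulk.zero : H1Bulk := ⟨(fun _ => 0, fun _ => 0), kinkedProfile_zero.isH1⟩

/-- **The wall world**: bulk block `𝔅(u) = mainTermForm u u′` on `H¹` bulk data, second data an arbitrary type `Q`
(wall value / band profile / jump records — the typers' objects), coupling and band block = the two functionals a
given `X`-world induces (`cross`, `band`: parameters, NOT asserted to be anything).
[cite: Zhang2022LandauSiegel, Prop 7.1 p.44, (7.2)] -/
def wallWorld (Q : Type) (cross : (ℝ → ℂ) → (ℝ → ℂ) → Q → ℂ) (band : Q → ℝ) : TwoBlockWorld H1Bulk Q where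
  bulk p := mainTermForm p.1.1 p.1.2
  cross p q := cross p.1.1 p.1.2 q
  band := band

variable {Q : Type} {cross : (ℝ → ℂ) → (ℝ → ℂ) → Q → ℂ} {band : Q → ℝ}

/-- In the wall world the bulk blocks are `≥ 0` — a THEOREM (`𝔅 ⪰ 0` on all of `H¹[0,1]`,
`mainTermForm_nonneg_of_isH1`; no condition at the wall). [cite: Zhang2022LandauSiegel, Prop 7.1 p.44, (7.2)] -/
theorem wallWorld_bulkNonneg : (wallWorld Q cross band).BulkNonneg := fun p => mainTermForm_nonneg_of_isH1 p.2

/-- **THE CRITERION in the wall world**: no truncated-at-the-wall design `s·u ⊕ w` closes iff the band blocks are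
`≥ 0` (slot E-005/E-034, the (B1) sign) and the bulk × band couplings are subordinate (slot E-006).
[cite: Zhang2022LandauSiegel, Prop 7.1 p.44, (7.2)] -/
theorem wallWorld_null_iff :
    (wallWorld Q cross band).Null ↔ (wallWorld Q cross band).BandNonneg ∧ (wallWorld Q cross band).CrossSubordinate :=
  TwoBlockWorld.null_iff ⟨H1Bulk.zero⟩ wallWorld_bulkNonneg

/-- the lever in the wall world: closing with band blocks `≥ 0` needs a bulk × band coupling of E*-strength
(row E-035: `𝔅(u)·r(w) < ‖c(u,w)‖²`). [cite: Zhang2022LandauSiegel, Prop 7.1 p.44, (7.2)] -/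
theorem wallWorld_closes_needs_cross (hb : (wallWorld Q cross band).BandNonneg) (h : (wallWorld Q cross band).Closes) :
    ∃ (p : H1Bulk) (q : Q), mainTermForm p.1.1 p.1.2 * band q < ‖cross p.1.1 p.1.2 q‖ ^ 2 :=
  TwoBlockWorld.closes_needs_cross wallWorld_bulkNonneg hb h

/-! ### Part 4 — the family «wall / band designs» for the extension protocol of `RepairRplus` -/

/-- **The family «bulk `H¹` profile truncated at the wall ⊕ wall/band datum of type `Q`, `X`-world currency»**:
designs `(u, u′, w, s)`; class = `u ∈ H¹[0,1]` (wall value free; NO analytic hypothesis); verdict = in EVERY world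
`(cross, band)` on these data whose band blocks are `≥ 0` (slot E-005/E-034) and whose couplings are subordinate
(slot E-006), the constant of `s·u ⊕ w` is not negative. [cite: Zhang2022LandauSiegel, §7 (7.2) p.44] -/
def familyWall (Q : Type) : DesignFamily where
  Design := (ℝ → ℂ) × (ℝ → ℂ) × Q × ℂ
  InClass d := IsH1OnUnitInterval d.1 d.2.1
  Verdict d := ∀ (cross : (ℝ → ℂ) → (ℝ → ℂ) → Q → ℂ) (band : Q → ℝ),
    (wallWorld Q cross band).BandNonneg → (wallWorld Q cross band).CrossSubordinate →
      ¬ (twoBlockPencil (mainTermForm d.1 d.2.1) (cross d.1 d.2.1 d.2.2.1) (band d.2.2.1) d.2.2.2 < 0)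

/-- **The wall family is decided** (by the criterion; the bulk positivity is the theorem `𝔅 ⪰ 0` on `H¹`).
[cite: Zhang2022LandauSiegel, §7 (7.2) p.44] -/
theorem familyWall_decided (Q : Type) : (familyWall Q).Decided := by
  intro d hd cross band hb hc
  exact not_lt.2 ((twoBlockPencil_nonneg_iff (mainTermForm_nonneg_of_isH1 hd)).2
    ⟨hb d.2.2.1, hc ⟨(d.1, d.2.1), hd⟩ d.2.2.1⟩ d.2.2.2)

/-- **`R⁺ ++ [wall family]` is decided** (`Repair.rplus_extend`). [cite: Zhang2022LandauSiegel, §7 (7.2) p.44] -/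
theorem rplus_wall_decided (Q : Type) : ClassDecided (Rplus ++ [familyWall Q]) :=
  rplus_extend (familyWall_decided Q)

/-- The family verdict is slot-conditional and the slots are load-bearing in the abstract: for ANY bulk profile `u`
with `𝔅(u) > 0` and any datum `w` there is a world with band block `≥ 0` in which `s·u ⊕ w` closes (coupling
`c = 𝔅(u) + 1`, band `r = 𝔅(u)`: `a·r = 𝔅² < (𝔅+1)²`) — so the verdict cannot drop `CrossSubordinate`.
[cite: Zhang2022LandauSiegel, §7 (7.2) p.44] -/
theorem familyWall_cross_slot_loadBearing {u u' : ℝ → ℂ} (hu : IsH1OnUnitInterval u u') (w : Q) :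
    ∃ (cross : (ℝ → ℂ) → (ℝ → ℂ) → Q → ℂ) (band : Q → ℝ),
      (wallWorld Q cross band).BandNonneg ∧ (wallWorld Q cross band).Closes := by
  set a : ℝ := mainTermForm u u' with ha
  have ha0 : 0 ≤ a := mainTermForm_nonneg_of_isH1 hu
  refine ⟨fun _ _ _ => ((a + 1 : ℝ) : ℂ), fun _ => a, fun _ => ha0, ?_⟩
  refine TwoBlockWorld.closes_of_cross wallWorld_bulkNonneg (p := ⟨(u, u'), hu⟩) (q := w) ?_
  change mainTermForm u u' * a < ‖((a + 1 : ℝ) : ℂ)‖ ^ 2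
  rw [← ha, Complex.norm_real, Real.norm_eq_abs, sq_abs]
  nlinarith

end KnifeEdge

end Literature.NumberTheory.LFunctions.Zhang2022
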